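/-
Origin: expansion seat `prover-pub-hodgecm-mc-sinst-1-g10-0`, handover #1254 2026-08-21T01:03Z md5 3932b8d3212b (603 l.; NEW additive DROP-ALONE leaf; ns HodgeCM.EquivariantLift (§1 generic: liftEquiv = an intertwining k-linear equivalence packaged as ρ.asModule ≃ₗ[k[G]] ρ'.asModule, + _apply ∕ _symm_apply; iSup_range_le_of_surjective, iSup_range_eq_of_equiv = BLOCK INVARIANCE ⨆ ψ : M →ₗ[A] T, (range ψ).restrictScalars k under M ≃ₗ[A] M′) + ns HodgeCM.Model.ThetaAdelicSide (§2 slot 0: def splitLineZero : SplitLine (diagonal (frameD V)) (realDiagonal …) (complexConj_imagUnit L) (imagUnit_ne_zero L) (imagUnit_mul_self L) (realDiagonal_isSymm …) (isUnit_det_realDiagonal … (frameD_ne V)) (realDiagonal_map …).symm with n := 3, e := e₁, JW := diagonal (lineVec L (dW c.D 0)), TW := realDiagonal L (lineVec …) _, s := splittingOf … hGR₀, hs := splittingOf_isCompatible … hGR₀; defs cVZero ∕ cWZero (= finCharZero (·,1) ∕ (1,·)), chiZero χ (+ chiFin_thetaDistDatumZeroOf : D₀.chiFin χ = chiZero χ,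 rfl), psiZero χ := chiZero χ · cWZero⁻¹ (+ chiZero_eq_mul_psiZero); ωfW_ ∕ ωfV_thetaDistDatumZeroOf_finSBReindex; def coinvEquivZero (ψ) (hψ : ∀ u, chiZero χ u = finCharZero (1,u) * ψ u) : Coinv (finPairRepW … splitLineZero.hs) ψ ≃ₗ[ℂ] Coinv D₀.ωfW (D₀.chiFin χ) (theta-3 TwistedCoinv.mapEquiv along finSBReindex e₁), coinvEquivZero_mk, coinvRep_coinvEquivZero (INTERTWINING LAW: D₀.coinvRep χ g (E x) = finCharZero (g,1) • E (weilCoinv … ψ splitLineZero.hs (finFrameCongr g) x)), coinvEquivZero_twist, def ΩEquivZero : (SeesawScalar.twist cVZero ((weilCoinv … ψ splitLineZero.hs).comp finFrameCongr)).asModule ≃ₗ[adelicAlgebra V] (D₀.coinvRep χ).asModule, iSup_range_coinvRep_zero_eq (blocks equal); §3 slot 1 verbatim with One ∕ hGR₁ ∕ eta₁ ∕ finCharOne; §3c slot 1 UNTWISTED: cVOne_apply_eq_one (cVOne g = 1), finCharOne_inl_eq_one, coinvEquivOne_weilCoinv, def dictEquivOne : (splitLineOne V c hGR₁).Ω (finFrameCongr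 …) ψ ≃ₗ[adelicAlgebra V] (D₁.coinvRep χ).asModule, iSup_range_coinvRep_one_eq_dict); D₀ = thetaDistDatumZeroOf V c hGR hGR₀ hGR₁ hGR₂ hGR₃ η hη hηc h₁W A hV Φarch harm hdef for EVERY (Φarch, harm, hdef) — so binder-1's pinDatumZero ∕ One by unfolding; NAMES for audit: HodgeCM.EquivariantLift.iSup_range_eq_of_equiv · HodgeCM.Model.ThetaAdelicSide.coinvRep_coinvEquivZero · HodgeCM.Model.ThetaAdelicSide.iSup_range_coinvRep_one_eq) (`HOME/mc/pub-hodgecm-mc-sinst-1-g10/stage69/HodgeCM/Model/AdelicThetaDistributionBridge.lean`, md5 3932b8d3212b, 603 lines);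
landed by the gen-29 packager (p-g29) in gate run 69 as `HodgeCM/Model/AdelicThetaDistributionBridge.lean` (verbatim).
-/
/-
Copyright (c) 2026 the pub-hodgecm formalisation cell (harness21).  New file, not vendored.
Origin: session prover-pub-hodgecm-mc-sinst-1-g10-0 (unit pub-hodgecm-mc-sinst-1-g10, S-INSTANCE CONSTRUCTOR gen 10; the (J4)↔(J3)
BRIDGE of the (J-Liu-Θ) junction behind E's row 9 `hΘ`: the honest slot modules `Ω₀(χ)`, `Ω₁(χ)` — `(thetaDistDatumZeroOf …).coinvRep χ`,
`(thetaDistDatumOneOf …).coinvRep χ` of #1248/#1250, the modules whose tower blocks carry the theta classes in binder-1's #R124/#R125 —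
ARE, as `ℂ[U(V)(𝔸_f)]`-modules, character twists of carriers of axioms-1's Weil-coinvariant dictionary (#4 `SplitLine.Ω`) at the
framed datum `JV := diagonal (frameD V)`, `ιV := finFrameCongr`), 2026-08-21.
Intended final place: `HodgeCM/Model/AdelicThetaDistributionBridge.lean` (NEW additive model-layer leaf; imports sinst-1 #1248
`AdelicThetaDistributionBlock`, #1250 `AdelicThetaDistributionOf`, axioms-1 #4 `LiuDictionaryInstance`, sinst-1-g9 #1237
`Binders/EquivariantLift`; nothing imports it; drop alone).
-/
import Summits.HodgeConjecture.HodgeCM.Model.AdelicThetaDistributionBlock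
import Summits.HodgeConjecture.HodgeCM.Model.AdelicThetaDistributionOf
import Summits.HodgeConjecture.HodgeCM.Model.LiuDictionaryInstance
import Summits.HodgeConjecture.HodgeCM.Model.Binders.EquivariantLift

set_option autoImplicit false

/-!
# The honest slot modules as twisted Weil-coinvariant dictionary carriers

The (J4) side (sinst-1 #1246–#1251, binder-1 #R123–#R125) lands every saturated holomorphic theta form of slot `k ∈ {0, 1}` of
the honest adèlic side `archSideOf …` in the tower block `⨆ ψ : Ω_k(χ) →ₗ[ℂ[U(V)(𝔸_f)]] Tower, range ψ` of
**`Ω_k(χ) := ((thetaDistDatum{Zero,One}Of …).coinvRep χ).asModule`** — the `chiFin χ`-coinvariants of the slot's finite Weil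
factor `finRep{Zero,One}` under the finite line torus `U(⟨a_k⟩)(𝔸_f)`.  The (J3) side (axioms-1 #4/#6/#7) indexes Liu's modules by
lines-with-splitting `p : SplitLine JV TV …` and characters `χ′` of `U(W)(𝔸_f)`, with carrier
**`p.Ω ιV χ′ := ((weilCoinv … χ′ p.hs).comp ιV).asModule`**.

By DEFINITION (#1249 `finRepZero`) the slot's finite factor is the dictionary's finite pair representation of the record
`splitLineZero` (the framed line `⟨a₀⟩`, enumeration `e₁`, the chosen compatible splitting `splittingOf hGR₀`), reindexed along
`finSBReindex e₁`, pulled back along `finFrameCongr × id`, and TWISTED by the scalar see-saw character `finCharZero`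
([Howe1979 §3]; [GelbartRogawski1991, §3.1 Remark p. 457]: two splittings differ by a character).  Hence (this file, KERNEL only):

* § 1 (generic algebra, ns `HodgeCM.EquivariantLift`) **`liftEquiv`**: an intertwining `k`-linear equivalence of two representations
  packaged as a `k[G]`-linear equivalence of their `asModule` synonyms; **`iSup_range_eq_of_equiv`**: the tower block
  `⨆ ψ : M →ₗ[A] T, (range ψ)|_k` is invariant under `M ≃ₗ[A] M′`.
* § 2 (slot 0) **`splitLineZero`** (the index record), **`coinvEquivZero`**: for every character `ψ` of `U(⟨a₀⟩)(𝔸_f)` with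
  `chiFin χ = finCharZero(1, ·) · ψ` (pointwise hypothesis `hψ`; canonical solution `psiZero`, `chiZero_eq_mul_psiZero`),
  `Coinv (finPairRepW splitLineZero.hs) ψ ≃ₗ[ℂ] Coinv Ω₀-carrier` (theta-3's `TwistedCoinv.mapEquiv` along `finSBReindex e₁` with the
  unit family `finCharZero(1, ·)`), its INTERTWINING LAW **`coinvRep_coinvEquivZero`**
  (`Ω₀(χ)(g) ∘ E = finCharZero(g, 1) • E ∘ Ω(splitLineZero, ψ)(finFrameCongr g)`), the `ℂ[U(V)(𝔸_f)]`-linear packaging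
  **`ΩEquivZero : (twist cVZero (Ω(splitLineZero, ψ) ∘ finFrameCongr)).asModule ≃ₗ Ω₀(χ)`** and the block identity
  **`iSup_range_coinvRep_zero_eq`**.
* § 3 (slot 1) the same with `One`; and § 3c: slot 1 carries NO `U(V)(𝔸_f)`-twist (**`cVOne_apply_eq_one`**: the `V`-dependence
  of `η` and the see-saw character `λ_V′` both sit in slot 0), so **`dictEquivOne : Ω(splitLineOne, ψ) ≃ₗ[ℂ[U(V)(𝔸_f)]] Ω₁(χ)`** —
  the honest slot-1 module IS a dictionary carrier at `ιV := finFrameCongr` (the `A`-linear surjection the pinned junction's block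
  socket consumes, as an isomorphism), with **`iSup_range_coinvRep_one_eq_dict`**.

What is NOT here: for slot 0 the identification of the `cVZero`-twisted carrier with the carrier of a TWISTED RECORD
`splitLineZero.twistBy ĉ hĉ` (axioms-1 #7/#8 `SplitLine.twistBy`, `Ω_twistBy_eq_twist`) — it needs a big character `ĉ` of
`U(J_V ⊗ J_W)(𝔸)` with `twistCharV ĉ ∘ finFrameCongr = cVZero` and its rational triviality; that arithmetic step is a separate leaf.
KERNEL only: data `def`s (one index record, characters, linear equivalences), 0 records of published sentences, 0 `def … : Prop`,
nothing cited as a hypothesis; `#print axioms` ⊆ {propext, Classical.choice, Quot.sound}.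
-/

noncomputable section

/-! ## § 1. Generic algebra -/

namespace HodgeCM
namespace EquivariantLift

open Representation

section Equiv

variable {k G : Type*} [CommSemiring k] [Monoid G]
variable {M M' : Type*} [AddCommMonoid M] [Module k M] [AddCommMonoid M'] [Module k M']
  (ρ : Representation k G M) (ρ' : Representation k G M')
  (e : M ≃ₗ[k] M') (he : ∀ (g : G) (m : M), e (ρ g m) = ρ' g (e m))

include he in
/-- the inverse of an intertwining equivalence intertwines. [folklore] -/
theorem symm_intertwines (g : G) (m' : M') : e.symm (ρ' g m') = ρ g (e.symm m') :=
  e.injective (by rw [he, e.apply_symm_apply, e.apply_symm_apply])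

include he in
/-- the hypothesis of `lift` for `asModuleEquiv.symm ∘ e`. [folklore] -/
theorem lift_hyp_of_intertwines (g : G) (m : M) :
    (ρ'.asModuleEquiv.symm.toLinearMap ∘ₗ e.toLinearMap) (ρ g m) =
      MonoidAlgebra.of k G g • (ρ'.asModuleEquiv.symm.toLinearMap ∘ₗ e.toLinearMap) m := by
  simp only [LinearMap.coe_comp, LinearEquiv.coe_coe, Function.comp_apply, he, asModuleEquiv_symm_map_rho]

/-- **An intertwining `k`-linear equivalence `e : (M, ρ) ≃ (M′, ρ′)` as a `k[G]`-linear equivalence `ρ.asModule ≃ ρ′.asModule`.**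
[folklore] -/
def liftEquiv : ρ.asModule ≃ₗ[MonoidAlgebra k G] ρ'.asModule :=
  LinearEquiv.ofLinear
    (lift ρ (ρ'.asModuleEquiv.symm.toLinearMap ∘ₗ e.toLinearMap) (lift_hyp_of_intertwines ρ ρ' e he))
    (lift ρ' (ρ.asModuleEquiv.symm.toLinearMap ∘ₗ e.symm.toLinearMap)
      (lift_hyp_of_intertwines ρ' ρ e.symm (symm_intertwines ρ ρ' e he)))
    (LinearMap.ext fun v => by
      simp only [LinearMap.comp_apply, LinearMap.id_apply, lift_apply, LinearEquiv.coe_coe, LinearEquiv.apply_symm_apply,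
        LinearEquiv.symm_apply_apply])
    (LinearMap.ext fun v => by
      simp only [LinearMap.comp_apply, LinearMap.id_apply, lift_apply, LinearEquiv.coe_coe, LinearEquiv.apply_symm_apply,
        LinearEquiv.symm_apply_apply])

/-- values of `liftEquiv` (the synonyms read through `asModuleEquiv`). [folklore] -/
@[simp] theorem liftEquiv_apply (v : ρ.asModule) :
    liftEquiv ρ ρ' e he v = ρ'.asModuleEquiv.symm (e (ρ.asModuleEquiv v)) := rfl

/-- values of `liftEquiv.symm`. [folklore] -/
@[simp] theorem liftEquiv_symm_apply (w : ρ'.asModule) :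
    (liftEquiv ρ ρ' e he).symm w = ρ.asModuleEquiv.symm (e.symm (ρ'.asModuleEquiv w)) := rfl

end Equiv

section Block

variable {k A T : Type*} [Semiring k] [Semiring A] [AddCommMonoid T] [Module k T] [Module A T] [SMul k A]
  [IsScalarTower k A T]
variable {M M' : Type*} [AddCommMonoid M] [Module A M] [AddCommMonoid M'] [Module A M']

/-- the block `⨆ ψ : M →ₗ[A] T, (range ψ)|_k` only grows along an `A`-linear surjection `M′ ↠ M`. [folklore] -/
theorem iSup_range_le_of_surjective (f : M' →ₗ[A] M) (hf : Function.Surjective f) :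
    (⨆ ψ : M →ₗ[A] T, (LinearMap.range ψ).restrictScalars k) ≤
      ⨆ ψ : M' →ₗ[A] T, (LinearMap.range ψ).restrictScalars k :=
  iSup_le fun ψ => le_iSup_of_le (ψ ∘ₗ f) (by rw [LinearMap.range_comp_of_range_eq_top ψ (LinearMap.range_eq_top.2 hf)])

/-- **BLOCK INVARIANCE**: `⨆ ψ : M →ₗ[A] T, (range ψ)|_k = ⨆ ψ : M′ →ₗ[A] T, (range ψ)|_k` for `M ≃ₗ[A] M′`. [folklore] -/
theorem iSup_range_eq_of_equiv (e : M ≃ₗ[A] M') :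
    (⨆ ψ : M →ₗ[A] T, (LinearMap.range ψ).restrictScalars k) =
      ⨆ ψ : M' →ₗ[A] T, (LinearMap.range ψ).restrictScalars k :=
  le_antisymm (iSup_range_le_of_surjective e.symm.toLinearMap e.symm.surjective)
    (iSup_range_le_of_surjective e.toLinearMap e.surjective)

end Block

end EquivariantLift
end HodgeCM

/-! ## § 2. Slot 0 -/

open MulAction IsDedekindDomain NumberField.mixedEmbedding
open NumberField hiding relNormOneIdeles relNormOneRat probHaarRelNormOneQuot
open scoped Matrix TensorProduct Classical SchwartzMap
open Literature.NumberTheory.Automorphic Literature.NumberTheory.Weil1964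
open Literature.NumberTheory.GelbartRogawski1991 Literature.NumberTheory.GelbartRogawski1991.UnitaryDualPair
open Literature.RepresentationTheory (SeesawScalar.twist SeesawScalar.twist_apply)
open Literature.Geometry.ComplexHyperbolic.BallModel (U21 x₀)
open Literature.AlgebraicGeometry.ShimuraVarieties
open HodgeCM.Adelic HodgeCM.PerL34 HodgeCM.Model.ArchSideTerm HodgeCM.Model.ThetaDistFin

namespace HodgeCM.Model
namespace ThetaAdelicSide

variable {L : CMField} {ι₁ : L →+* ℂ} (V : HermSpace3 L ι₁) (c : SeesawCtx L)
  (hGR : (cmSplittingDatum (L : Type) finProdFinEquiv (frameD V) (frameD_real V) (frameD_ne V) (dW c.D) (dW_real c.D)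
    (dW_ne c.D)).CompatibleSplitting)
  (hGR₀ : (cmSplittingDatum (L : Type) (e₁) (frameD V) (frameD_real V) (frameD_ne V) (lineVec (L : Type) (dW c.D 0))
    (fun _ => dW_real c.D 0) (fun _ => dW_ne c.D 0)).CompatibleSplitting)
  (hGR₁ : (cmSplittingDatum (L : Type) (e₁) (frameD V) (frameD_real V) (frameD_ne V) (lineVec (L : Type) (dW c.D 1))
    (fun _ => dW_real c.D 1) (fun _ => dW_ne c.D 1)).CompatibleSplitting)
  (hGR₂ : (cmSplittingDatum (L : Type) (e₁) (frameD V) (frameD_real V) (frameD_ne V) (lineVec (L : Type) (dW' c.D 0))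
    (fun _ => dW'_real c.D 0) (fun _ => dW'_ne c.D 0)).CompatibleSplitting)
  (hGR₃ : (cmSplittingDatum (L : Type) (e₁) (frameD V) (frameD_real V) (frameD_ne V) (lineVec (L : Type) (dW' c.D 1))
    (fun _ => dW'_real c.D 1) (fun _ => dW'_ne c.D 1)).CompatibleSplitting)
  (η : CMAdelic (L : Type) (frameD V) × CMAdelic (L : Type) (dW c.D) →* ℂˣ)
  (hη : ∀ γU ∈ CMRat (L : Type) (frameD V), ∀ γ ∈ CMRat (L : Type) (dW c.D), η (γU, γ) = 1)
  (hηc : Continuous fun p => ((η p : ℂˣ) : ℂ))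
  (h₁W : (∀ j, 0 < (ι₁ (dW c.D j)).re) ∨ ∀ j, (ι₁ (dW c.D j)).re < 0)
  (A : ∀ k : Fin 4, ArchLineInput V (lineRepD V c.D hGR hGR₀ hGR₁ hGR₂ hGR₃ η k))
  (hV : IsAnisotropic L V.Hm)

/-! ### § 2a. The index record and the characters of slot 0 -/

/-- **the dictionary index record of slot 0**: the framed hermitian line `⟨a₀⟩` (`a₀ = dW c.D 0`) over `L`, enumeration `e₁`,
with the CHOSEN compatible pair splitting `splittingOf hGR₀` of `U(diag frameD V) × U(⟨a₀⟩)` ([GelbartRogawski1991, Prop. 3.1.1] as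
cited by `hGR₀`) — a `SplitLine` at the framed `V`-datum `JV := diagonal (frameD V)`. -/
def splitLineZero :
    SplitLine (Matrix.diagonal (frameD V)) (realDiagonal (L : Type) (frameD V) (frameD_real V))
      (complexConj_imagUnit (L : Type)) (imagUnit_ne_zero (L : Type)) (imagUnit_mul_self (L : Type))
      (realDiagonal_isSymm (L : Type) (frameD V) (frameD_real V))
      (isUnit_det_realDiagonal (L : Type) (frameD V) (frameD_real V) (frameD_ne V))
      (realDiagonal_map (L : Type) (frameD V) (frameD_real V)).symm where
  n := 3
  e := e₁
  JW := Matrix.diagonal (lineVec (L : Type) (dW c.D 0))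
  TW := realDiagonal (L : Type) (lineVec (L : Type) (dW c.D 0)) fun _ => dW_real c.D 0
  hW := realDiagonal_isSymm (L : Type) (lineVec (L : Type) (dW c.D 0)) fun _ => dW_real c.D 0
  hWd := isUnit_det_realDiagonal (L : Type) (lineVec (L : Type) (dW c.D 0)) (fun _ => dW_real c.D 0) fun _ => dW_ne c.D 0
  hJW := (realDiagonal_map (L : Type) (lineVec (L : Type) (dW c.D 0)) fun _ => dW_real c.D 0).symm
  s := splittingOf _ _ _ _ _ _ _ _ _ _ _ _ _ _ _ _ _ hGR₀
  hs := splittingOf_isCompatible _ _ _ _ _ _ _ _ _ _ _ _ _ _ _ _ _ hGR₀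

/-- **`c_{V,0} : k ↦ finCharZero (k, 1)`** — the `U(V)(𝔸_f)`-part of the scalar see-saw character of slot 0. -/
def cVZero : ↥V.adelicFin →* ℂˣ :=
  (finCharZero V c.D hGR hGR₀ hGR₁ (eta₀ V c.D η)).comp (MonoidHom.inl _ _)

/-- **`c_{W,0} : u ↦ finCharZero (1, u)`** — its `U(⟨a₀⟩)(𝔸_f)`-part. -/
def cWZero : UfZero c.D →* ℂˣ :=
  (finCharZero V c.D hGR hGR₀ hGR₁ (eta₀ V c.D η)).comp (MonoidHom.inr _ _)

/-- (Ported verbatim from the HodgeCMPerL package; no docstring in the source.) -/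
@[simp] theorem cVZero_apply (g : ↥V.adelicFin) :
    cVZero V c hGR hGR₀ hGR₁ η g = finCharZero V c.D hGR hGR₀ hGR₁ (eta₀ V c.D η) (g, 1) := rfl

/-- (Ported verbatim from the HodgeCMPerL package; no docstring in the source.) -/
@[simp] theorem cWZero_apply (u : UfZero c.D) :
    cWZero V c hGR hGR₀ hGR₁ η u = finCharZero V c.D hGR hGR₀ hGR₁ (eta₀ V c.D η) (1, u) := rfl

/-- **`χ ↦ chiZero χ : u ↦ χ(finLineTorusIdeles u)⁻¹`** — the coinvariant character of slot 0 (the `chiFin` of every slot-0 datum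
`thetaDistDatumZeroOf …`, definitionally: `chiFin_thetaDistDatumZeroOf`). -/
def chiZero (χ : PontryaginDual (↥(relNormOneIdeles (↥(maximalRealSubfield L)) L) ⧸ relNormOneRat (↥(maximalRealSubfield L)) L)) :
    UfZero c.D →* ℂˣ :=
  (Circle.toUnits : Circle →* ℂˣ).comp <| (invMonoidHom : Circle →* Circle).comp <|
    (χ : ↥(relNormOneIdeles (↥(maximalRealSubfield L)) L) ⧸ relNormOneRat (↥(maximalRealSubfield L)) L →* Circle).comp <|
      (QuotientGroup.mk' (relNormOneRat (↥(maximalRealSubfield L)) L)).comp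
        (finLineTorusIdeles (L : Type) (dW c.D 0) (dW_ne c.D 0))

/-- **the canonical dictionary-side character `ψ₀(χ) := chiZero χ · c_{W,0}⁻¹`**. -/
def psiZero (χ : PontryaginDual (↥(relNormOneIdeles (↥(maximalRealSubfield L)) L) ⧸ relNormOneRat (↥(maximalRealSubfield L)) L)) :
    UfZero c.D →* ℂˣ :=
  chiZero c χ * (cWZero V c hGR hGR₀ hGR₁ η)⁻¹

/-- `chiZero χ = c_{W,0} · ψ₀(χ)` pointwise (the hypothesis `hψ` below, for `ψ := psiZero χ`). -/
theorem chiZero_eq_mul_psiZero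
    (χ : PontryaginDual (↥(relNormOneIdeles (↥(maximalRealSubfield L)) L) ⧸ relNormOneRat (↥(maximalRealSubfield L)) L))
    (u : UfZero c.D) :
    chiZero c χ u = finCharZero V c.D hGR hGR₀ hGR₁ (eta₀ V c.D η) (1, u) * psiZero V c hGR hGR₀ hGR₁ η χ u := by
  rw [psiZero, MonoidHom.mul_apply, MonoidHom.inv_apply, cWZero_apply, mul_comm (chiZero c χ u), ← mul_assoc, mul_inv_cancel,
    one_mul]

/-- `chiFin` of every slot-0 datum IS `chiZero` (definitional: `toIdele := finLineTorusIdeles …`). -/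
theorem chiFin_thetaDistDatumZeroOf
    (Φarch : Module.Dual ℂ (Fin 2 → ℂ) →ₗ[ℂ] 𝓢((Fin 3 → mixedSpace (↥(maximalRealSubfield L))), ℂ))
    (harm : ∀ (u : ↥(stabilizer U21 x₀)) (ℓ : Module.Dual ℂ (Fin 2 → ℂ)),
      lineOmega_zero V c.D hGR hGR₀ hGR₁ (eta₀ V c.D η) (u : U21) (Φarch ℓ) =
        Φarch ((BallForms.isPullbackCocycle_cotangentCocycle.weightOf x₀).dual u ℓ))
    (hdef : ∀ a : UnitaryGroup.arch (↥(maximalRealSubfield L)) L (IsCMField.complexConj L) 3 V.Hm,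
      UnitaryGroup.archAt (↥(maximalRealSubfield L)) L (IsCMField.complexConj L) 3 V.Hm (UnitaryGroup.cmPlace (L : Type) ι₁)
          (NumberField.complexConj_smul_infinitePlace (L : Type) _) (IsCMField.complexConj_ne_one (L : Type)) a = 1 →
      ∀ (ℓ : Module.Dual ℂ (Fin 2 → ℂ)) (Φf : FinSB (↥(maximalRealSubfield L)) (Fin 3)),
        lineRepOf V c.D hGR hGR₀ hGR₁ hGR₂ hGR₃ (eta₀ V c.D η) (eta₁ V c.D η) (eta₂ V c.D η) (eta₃ V c.D η) 0
            (HodgeCM.Adelic.regimeEquiv L V.Hm hV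
              (UnitaryGroup.archToAdelic (↥(maximalRealSubfield L)) L (IsCMField.complexConj L) 3 V.Hm a), 1)
            (piSchwartzBruhatEquiv (↥(maximalRealSubfield L)) (Fin 3) (Φarch ℓ ⊗ₜ[ℂ] Φf)) =
          piSchwartzBruhatEquiv (↥(maximalRealSubfield L)) (Fin 3) (Φarch ℓ ⊗ₜ[ℂ] Φf))
    (χ : PontryaginDual (↥(relNormOneIdeles (↥(maximalRealSubfield L)) L) ⧸ relNormOneRat (↥(maximalRealSubfield L)) L)) :
    (thetaDistDatumZeroOf V c hGR hGR₀ hGR₁ hGR₂ hGR₃ η hη hηc h₁W A hV Φarch harm hdef).chiFin χ = chiZero c χ := rfl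

/-! ### § 2b. The coinvariant comparison of slot 0 -/

section Zero

variable (Φarch : Module.Dual ℂ (Fin 2 → ℂ) →ₗ[ℂ] 𝓢((Fin 3 → mixedSpace (↥(maximalRealSubfield L))), ℂ))
  (harm : ∀ (u : ↥(stabilizer U21 x₀)) (ℓ : Module.Dual ℂ (Fin 2 → ℂ)),
    lineOmega_zero V c.D hGR hGR₀ hGR₁ (eta₀ V c.D η) (u : U21) (Φarch ℓ) =
      Φarch ((BallForms.isPullbackCocycle_cotangentCocycle.weightOf x₀).dual u ℓ))
  (hdef : ∀ a : UnitaryGroup.arch (↥(maximalRealSubfield L)) L (IsCMField.complexConj L) 3 V.Hm,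
    UnitaryGroup.archAt (↥(maximalRealSubfield L)) L (IsCMField.complexConj L) 3 V.Hm (UnitaryGroup.cmPlace (L : Type) ι₁)
        (NumberField.complexConj_smul_infinitePlace (L : Type) _) (IsCMField.complexConj_ne_one (L : Type)) a = 1 →
    ∀ (ℓ : Module.Dual ℂ (Fin 2 → ℂ)) (Φf : FinSB (↥(maximalRealSubfield L)) (Fin 3)),
      lineRepOf V c.D hGR hGR₀ hGR₁ hGR₂ hGR₃ (eta₀ V c.D η) (eta₁ V c.D η) (eta₂ V c.D η) (eta₃ V c.D η) 0
          (HodgeCM.Adelic.regimeEquiv L V.Hm hV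
            (UnitaryGroup.archToAdelic (↥(maximalRealSubfield L)) L (IsCMField.complexConj L) 3 V.Hm a), 1)
          (piSchwartzBruhatEquiv (↥(maximalRealSubfield L)) (Fin 3) (Φarch ℓ ⊗ₜ[ℂ] Φf)) =
        piSchwartzBruhatEquiv (↥(maximalRealSubfield L)) (Fin 3) (Φarch ℓ ⊗ₜ[ℂ] Φf))
  (χ : PontryaginDual (↥(relNormOneIdeles (↥(maximalRealSubfield L)) L) ⧸ relNormOneRat (↥(maximalRealSubfield L)) L))
  (ψ : UfZero c.D →* ℂˣ)
  (hψ : ∀ u : UfZero c.D, chiZero c χ u = finCharZero V c.D hGR hGR₀ hGR₁ (eta₀ V c.D η) (1, u) * ψ u)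

/-- (T-W) the `U(⟨a₀⟩)(𝔸_f)`-member of the slot's finite factor on reindexed vectors:
`ω_{f,W}(u) (R f) = finCharZero(1, u) • R (finPairRepW splitLineZero.hs u f)`. -/
theorem ωfW_thetaDistDatumZeroOf_finSBReindex (u : UfZero c.D) (f : FinSB (↥(maximalRealSubfield L)) (Fin 3 × Fin 1)) :
    (thetaDistDatumZeroOf V c hGR hGR₀ hGR₁ hGR₂ hGR₃ η hη hηc h₁W A hV Φarch harm hdef).ωfW u
        (finSBReindex (↥(maximalRealSubfield L)) e₁ f) =
      ((finCharZero V c.D hGR hGR₀ hGR₁ (eta₀ V c.D η) (1, u) : ℂˣ) : ℂ) •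
        finSBReindex (↥(maximalRealSubfield L)) e₁
          (HodgeCM.WeilCoinv.finPairRepW _ _ _ _ _ _ _ _ _ _ _ _ _ _ _ _ _ (splitLineZero V c hGR₀).hs u f) := by
  show finRepZero V c.D hGR hGR₀ hGR₁ (eta₀ V c.D η) (1, u) _ = _
  rw [finRepZero_apply, map_one, LinearEquiv.symm_apply_apply]
  rfl

/-- (T-V) the `U(V)(𝔸_f)`-member: `ω_{f,V}(g) (R f) = finCharZero(g, 1) • R (finPairRepV splitLineZero.hs (finFrameCongr g) f)`. -/
theorem ωfV_thetaDistDatumZeroOf_finSBReindex (g : ↥V.adelicFin) (f : FinSB (↥(maximalRealSubfield L)) (Fin 3 × Fin 1)) :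
    (thetaDistDatumZeroOf V c hGR hGR₀ hGR₁ hGR₂ hGR₃ η hη hηc h₁W A hV Φarch harm hdef).ωfV g
        (finSBReindex (↥(maximalRealSubfield L)) e₁ f) =
      ((finCharZero V c.D hGR hGR₀ hGR₁ (eta₀ V c.D η) (g, 1) : ℂˣ) : ℂ) •
        finSBReindex (↥(maximalRealSubfield L)) e₁
          (HodgeCM.WeilCoinv.finPairRepV _ _ _ _ _ _ _ _ _ _ _ _ _ _ _ _ _ (splitLineZero V c hGR₀).hs
            (finFrameCongr (L : Type) V.Hm (frameG V) (frameD V) (frame_congr V) g) f) := by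
  show finRepZero V c.D hGR hGR₀ hGR₁ (eta₀ V c.D η) (g, 1) _ = _
  rw [finRepZero_apply, LinearEquiv.symm_apply_apply]
  rfl

/-- **THE COINVARIANT COMPARISON OF SLOT 0**: for every character `ψ` of `U(⟨a₀⟩)(𝔸_f)` with `chiZero χ = finCharZero(1, ·) · ψ`,
`Coinv (finPairRepW splitLineZero.hs) ψ ≃ₗ[ℂ] Coinv ω_{f,W} (chiFin χ)` — the carrier of the dictionary module `Ω(splitLineZero, ψ)` and
the carrier of the honest slot module `Ω₀(χ)`; theta-3's `TwistedCoinv.mapEquiv` along the reindexing `finSBReindex e₁` with the unit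
family `finCharZero(1, ·)` (`mk f ↦ mk (R f)`). -/
def coinvEquivZero :
    TwistedCoinv.Coinv (HodgeCM.WeilCoinv.finPairRepW _ _ _ _ _ _ _ _ _ _ _ _ _ _ _ _ _ (splitLineZero V c hGR₀).hs) ψ ≃ₗ[ℂ]
      TwistedCoinv.Coinv (thetaDistDatumZeroOf V c hGR hGR₀ hGR₁ hGR₂ hGR₃ η hη hηc h₁W A hV Φarch harm hdef).ωfW
        ((thetaDistDatumZeroOf V c hGR hGR₀ hGR₁ hGR₂ hGR₃ η hη hηc h₁W A hV Φarch harm hdef).chiFin χ) :=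
  TwistedCoinv.mapEquiv _ ψ _ _ (finSBReindex (↥(maximalRealSubfield L)) e₁)
    (fun u => finCharZero V c.D hGR hGR₀ hGR₁ (eta₀ V c.D η) (1, u))
    (fun u f => ωfW_thetaDistDatumZeroOf_finSBReindex V c hGR hGR₀ hGR₁ hGR₂ hGR₃ η hη hηc h₁W A hV Φarch harm hdef u f) hψ

/-- `coinvEquivZero (mk f) = mk (R f)`. -/
@[simp] theorem coinvEquivZero_mk (f : FinSB (↥(maximalRealSubfield L)) (Fin 3 × Fin 1)) :
    coinvEquivZero V c hGR hGR₀ hGR₁ hGR₂ hGR₃ η hη hηc h₁W A hV Φarch harm hdef χ ψ hψ (TwistedCoinv.mk _ ψ f) =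
      TwistedCoinv.mk _ _ (finSBReindex (↥(maximalRealSubfield L)) e₁ f) := rfl

/-- **THE INTERTWINING LAW**: `Ω₀(χ)(g) (E x) = finCharZero(g, 1) • E (Ω(splitLineZero, ψ)(finFrameCongr g) x)` — the honest slot
module is the pullback along `finFrameCongr` of the dictionary module `Ω(splitLineZero, ψ) = weilCoinv … ψ splitLineZero.hs`, TWISTED
by `c_{V,0}`. [cite: GelbartRogawski1991, §3.1 Remark p. 457 L4–13] -/
theorem coinvRep_coinvEquivZero (g : ↥V.adelicFin)
    (x : TwistedCoinv.Coinv (HodgeCM.WeilCoinv.finPairRepW _ _ _ _ _ _ _ _ _ _ _ _ _ _ _ _ _ (splitLineZero V c hGR₀).hs) ψ) :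
    (thetaDistDatumZeroOf V c hGR hGR₀ hGR₁ hGR₂ hGR₃ η hη hηc h₁W A hV Φarch harm hdef).coinvRep χ g
        (coinvEquivZero V c hGR hGR₀ hGR₁ hGR₂ hGR₃ η hη hηc h₁W A hV Φarch harm hdef χ ψ hψ x) =
      ((finCharZero V c.D hGR hGR₀ hGR₁ (eta₀ V c.D η) (g, 1) : ℂˣ) : ℂ) •
        coinvEquivZero V c hGR hGR₀ hGR₁ hGR₂ hGR₃ η hη hηc h₁W A hV Φarch harm hdef χ ψ hψ
          (HodgeCM.WeilCoinv.weilCoinv _ _ _ _ _ _ _ _ _ _ _ _ _ _ _ _ _ ψ (splitLineZero V c hGR₀).hs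
            (finFrameCongr (L : Type) V.Hm (frameG V) (frameD V) (frame_congr V) g) x) :=
  TwistedCoinv.mapEquiv_rep _ ψ _ _
    (HodgeCM.WeilCoinv.finPairRepV _ _ _ _ _ _ _ _ _ _ _ _ _ _ _ _ _ (splitLineZero V c hGR₀).hs) _
    (HodgeCM.WeilCoinv.commute_finPairRepV_finPairRepW _ _ _ _ _ _ _ _ _ _ _ _ _ _ _ _ _ (splitLineZero V c hGR₀).hs)
    (thetaDistDatumZeroOf V c hGR hGR₀ hGR₁ hGR₂ hGR₃ η hη hηc h₁W A hV Φarch harm hdef).commute_ωfV_ωfW _ _ _ hψ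
    (fun f => ωfV_thetaDistDatumZeroOf_finSBReindex V c hGR hGR₀ hGR₁ hGR₂ hGR₃ η hη hηc h₁W A hV Φarch harm hdef g f) x

/-- the same law against the `c_{V,0}`-TWISTED PULLBACK `SeesawScalar.twist cVZero (Ω(splitLineZero, ψ) ∘ finFrameCongr)`:
`E ∘ (twist …)(g) = Ω₀(χ)(g) ∘ E`. -/
theorem coinvEquivZero_twist (g : ↥V.adelicFin)
    (x : TwistedCoinv.Coinv (HodgeCM.WeilCoinv.finPairRepW _ _ _ _ _ _ _ _ _ _ _ _ _ _ _ _ _ (splitLineZero V c hGR₀).hs) ψ) :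
    coinvEquivZero V c hGR hGR₀ hGR₁ hGR₂ hGR₃ η hη hηc h₁W A hV Φarch harm hdef χ ψ hψ
        (SeesawScalar.twist (cVZero V c hGR hGR₀ hGR₁ η)
          ((HodgeCM.WeilCoinv.weilCoinv _ _ _ _ _ _ _ _ _ _ _ _ _ _ _ _ _ ψ (splitLineZero V c hGR₀).hs).comp
            (finFrameCongr (L : Type) V.Hm (frameG V) (frameD V) (frame_congr V))) g x) =
      (thetaDistDatumZeroOf V c hGR hGR₀ hGR₁ hGR₂ hGR₃ η hη hηc h₁W A hV Φarch harm hdef).coinvRep χ g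
        (coinvEquivZero V c hGR hGR₀ hGR₁ hGR₂ hGR₃ η hη hηc h₁W A hV Φarch harm hdef χ ψ hψ x) := by
  rw [SeesawScalar.twist_apply, coinvRep_coinvEquivZero]
  exact map_smul (coinvEquivZero V c hGR hGR₀ hGR₁ hGR₂ hGR₃ η hη hηc h₁W A hV Φarch harm hdef χ ψ hψ) _ _

include hψ in
/-- **THE BRIDGE OF SLOT 0, module currency**: the `c_{V,0}`-twisted pullback of the dictionary carrier `Ω(splitLineZero, ψ)` IS the
honest slot module `Ω₀(χ)`, as `ℂ[U(V)(𝔸_f)]`-modules. -/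
def ΩEquivZero :
    (SeesawScalar.twist (cVZero V c hGR hGR₀ hGR₁ η)
          ((HodgeCM.WeilCoinv.weilCoinv _ _ _ _ _ _ _ _ _ _ _ _ _ _ _ _ _ ψ (splitLineZero V c hGR₀).hs).comp
            (finFrameCongr (L : Type) V.Hm (frameG V) (frameD V) (frame_congr V)))).asModule ≃ₗ[adelicAlgebra V]
      ((thetaDistDatumZeroOf V c hGR hGR₀ hGR₁ hGR₂ hGR₃ η hη hηc h₁W A hV Φarch harm hdef).coinvRep χ).asModule :=
  EquivariantLift.liftEquiv _ _ (coinvEquivZero V c hGR hGR₀ hGR₁ hGR₂ hGR₃ η hη hηc h₁W A hV Φarch harm hdef χ ψ hψ)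
    (coinvEquivZero_twist V c hGR hGR₀ hGR₁ hGR₂ hGR₃ η hη hηc h₁W A hV Φarch harm hdef χ ψ hψ)

include hψ in
/-- **BLOCKS EQUAL (slot 0)**: for every `ℂ[U(V)(𝔸_f)]`-module `T` (the tower),
`⨆ ψ′ : Ω₀(χ) →ₗ T, (range ψ′)|_ℂ = ⨆ ψ′ : (twist c_{V,0} (Ω(splitLineZero, ψ) ∘ finFrameCongr)).asModule →ₗ T, (range ψ′)|_ℂ`. -/
theorem iSup_range_coinvRep_zero_eq {T : Type*} [AddCommMonoid T] [Module ℂ T] [Module (adelicAlgebra V) T]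
    [IsScalarTower ℂ (adelicAlgebra V) T] :
    (⨆ f : ((thetaDistDatumZeroOf V c hGR hGR₀ hGR₁ hGR₂ hGR₃ η hη hηc h₁W A hV Φarch harm hdef).coinvRep χ).asModule
        →ₗ[adelicAlgebra V] T, (LinearMap.range f).restrictScalars ℂ) =
      ⨆ f : (SeesawScalar.twist (cVZero V c hGR hGR₀ hGR₁ η)
          ((HodgeCM.WeilCoinv.weilCoinv _ _ _ _ _ _ _ _ _ _ _ _ _ _ _ _ _ ψ (splitLineZero V c hGR₀).hs).comp
            (finFrameCongr (L : Type) V.Hm (frameG V) (frameD V) (frame_congr V)))).asModule →ₗ[adelicAlgebra V] T,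
        (LinearMap.range f).restrictScalars ℂ :=
  (EquivariantLift.iSup_range_eq_of_equiv
    (ΩEquivZero V c hGR hGR₀ hGR₁ hGR₂ hGR₃ η hη hηc h₁W A hV Φarch harm hdef χ ψ hψ)).symm

end Zero

/-! ## § 3. Slot 1 -/

/-! ### § 3a. The index record and the characters of slot 1 -/

/-- **the dictionary index record of slot 1**: the framed hermitian line `⟨a₁⟩` (`a₁ = dW c.D 1`) over `L`, enumeration `e₁`,
with the CHOSEN compatible pair splitting `splittingOf hGR₁` of `U(diag frameD V) × U(⟨a₁⟩)` ([GelbartRogawski1991, Prop. 3.1.1] as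
cited by `hGR₁`) — a `SplitLine` at the framed `V`-datum `JV := diagonal (frameD V)`. -/
def splitLineOne :
    SplitLine (Matrix.diagonal (frameD V)) (realDiagonal (L : Type) (frameD V) (frameD_real V))
      (complexConj_imagUnit (L : Type)) (imagUnit_ne_zero (L : Type)) (imagUnit_mul_self (L : Type))
      (realDiagonal_isSymm (L : Type) (frameD V) (frameD_real V))
      (isUnit_det_realDiagonal (L : Type) (frameD V) (frameD_real V) (frameD_ne V))
      (realDiagonal_map (L : Type) (frameD V) (frameD_real V)).symm where
  n := 3
  e := e₁
  JW := Matrix.diagonal (lineVec (L : Type) (dW c.D 1))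
  TW := realDiagonal (L : Type) (lineVec (L : Type) (dW c.D 1)) fun _ => dW_real c.D 1
  hW := realDiagonal_isSymm (L : Type) (lineVec (L : Type) (dW c.D 1)) fun _ => dW_real c.D 1
  hWd := isUnit_det_realDiagonal (L : Type) (lineVec (L : Type) (dW c.D 1)) (fun _ => dW_real c.D 1) fun _ => dW_ne c.D 1
  hJW := (realDiagonal_map (L : Type) (lineVec (L : Type) (dW c.D 1)) fun _ => dW_real c.D 1).symm
  s := splittingOf _ _ _ _ _ _ _ _ _ _ _ _ _ _ _ _ _ hGR₁
  hs := splittingOf_isCompatible _ _ _ _ _ _ _ _ _ _ _ _ _ _ _ _ _ hGR₁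

/-- **`c_{V,1} : k ↦ finCharOne (k, 1)`** — the `U(V)(𝔸_f)`-part of the scalar see-saw character of slot 1. -/
def cVOne : ↥V.adelicFin →* ℂˣ :=
  (finCharOne V c.D hGR hGR₀ hGR₁ (eta₁ V c.D η)).comp (MonoidHom.inl _ _)


-- port_pkg: scope closed for this part
end ThetaAdelicSide
end HodgeCM.Model
end
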